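/-
Origin: expansion seat `prover-pub-hodgecm-mc-binder-2-g12-0`, handover #52 2026-08-20T04:55Z md5 ac4208c68c66 (433 l.; CERTIFIED private mirror over PKG RUN-39 oleans: rc 0 / 0 err / 0 warn / 26.3 s; `#print axioms` of isoTwist_conj_archConjDiag · isoTwist · isoLocGL_mem · isoPerm_ratio_pos · torusSwap ⊆ {propext, Classical.choice, Quot.sound} (`g12/certs/axioms-52.log`); imports #33 `HypCensus/TorusLetters` (RUN 39) + pv11 `PerL34/TorusOccurrence`; (J-T34) ARCHIMEDEAN HALF: the (34) chart element `archConjDiag isoGL dW dW' u = g·diag(u)·g⁻¹` (#25) is conjugate INSIDE `U(diag dW)(L⁺⊗ℝ)` to the diagonal (12)-type torus with place-wise permuted entries: §1 (2×2) `isoPerm`, **`isoPerm_ratio_pos`** (Sylvester for 2×2 real diagonal forms: sign patterns of isometric forms agree up to `isoPerm`), `sign_facts_of_conjTranspose_mul_mul` (from `γᴴ·diag x·γ = diag x'`: definiteness + det sign transfer), `isoMat` = `P_σ·diag(√(x'ᵢ/x_{σ i}))` with `isoMatInv`, `isoMatGL`, **`conjTranspose_isoMat_mul_mul`** (`dᴴ·diag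 x·d = diag x'`), **`isoMat_mul_diagonal_mul_isoMatInv`** (`d·diag u·d⁻¹ = diag(u∘σ⁻¹)`); §2 at a complex place w: `placeRe`, `embedding_eq_placeRe` (conj-fixed ⇒ real under σ_w, tree `embedding_galConj`), `conjTranspose_map_embedding_mul_mul` (the rational isometry `hg` read at w), `placePerm`/`placeRatio_pos`, `isoLocGL w := GL₂(σ_w) g · d_w⁻¹`, **`isoLocGL_mem : isoLocGL w ∈ archLocal L 2 (diagonal dW) w`**; §3 **`isoTwist … : UnitaryGroup.arch L⁺ L c 2 (diagonal dW)`** (`archPiEquiv⁻¹` of the `isoLoc w`), `archAt_isoTwist`, `permPair`, **`torusSwap σ : SeesawArchTorus L →* SeesawArchTorus L`** (place-wise permutation of the two circle coordinates through pv11 `placesEquiv`), `placesEquiv_torusSwap`, `map_evalC_archGL`, `coe_map_evalC_archDiagGL`, HEADLINE **`isoTwist_conj_archConjDiag : (isoTwist …)⁻¹ * archConjDiag L g dW dW' hg u * isoTwist … = archDiag L dW (torusSwap L (fun w => (placePerm L dW dW' w).symm) u)`**. Consequence for rows 18/19 (successor leaf): the (34) fields of `HypSideW` at the W pin = the (12)-type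 fields transported by `ρ_η(archProdHom(1, isoTwist isoGL))` (preserves `𝒮^κ`, Weil's Θ-topology, conjugates the curves), so `omg_ins`@φ₀ for `jT₃₄` follows from #35/#37 at `torusSwap u` modulo the (34) value identity, and `ins_mem`/`smooth`/`dense` for (34) follow from the (12) ones with NO new hypothesis; 0 Prop-defs / 0 records; FQN scan vs PKG RUN-40 world: 0 collisions (`isoMatGL`/`coe_GL_map_eq_map` renamed away from `SeesawDatum.isoGL` / `UnitaryBallRealPoints.coe_generalLinearGroup_map`); NAME LIST `HodgeCM.Model.HypCensus.isoTwist_conj_archConjDiag` · `HodgeCM.Model.HypCensus.isoLocGL_mem` · `HodgeCM.Model.HypCensus.isoPerm_ratio_pos`) (`HOME/mc/pub-hodgecm-mc-binder-2/g12/pkg/HodgeCM/Model/HypCensus/IsoTwist.lean`, md5 ac4208c68c66, 433 lines);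
landed by the gen-15 packager (p-g15) in gate run 41 as `HodgeCM/Model/HypCensus/IsoTwist.lean` (verbatim).
-/
/-
Origin: speedrun cell pub-hodgecm, MODEL-CONSTRUCTION sub-cell, lineage mc-binder-2 (BINDER-OWNERS rows 18/19: E binders
`hyp12` / `hyp34`), seat prover-pub-hodgecm-mc-binder-2-g12-0 (gen 12), 2026-08-20.
Target in PKG: `HodgeCM/Model/HypCensus/IsoTwist.lean` (NEW additive leaf; imports this lineage's `HypCensus/TorusLetters` (#33, RUN 39) and
`HodgeCM.PerL34.TorusOccurrence` (pv11)).  KERNEL ONLY: 0 records, nothing cited as hypothesis, 0 `def … : Prop`.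
-/
import Summits.HodgeConjecture.HodgeCM.Model.HypCensus.TorusLetters
import Summits.HodgeConjecture.HodgeCM.PerL34.TorusOccurrence_2

/-!
# Census kit (rows A12/A34), junction (J-T34): the (34) torus is an ARCHIMEDEAN conjugate of the diagonal torus

The (34) chart point of E is `jT₃₄ (ι u) = (g · diag(u₀,u₁) · g⁻¹)_𝔸` with `g = D.isoMatGL : (L², diag(a₂,a₃)) ⥲ (L², diag(a₀,a₁))` the
RATIONAL isometry of the seesaw datum (#25 `cmAdelicEquiv_jT₃₄_toAdeles`, `archConjDiag`).  Its place components are NOT diagonal in the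
canonical frame of the W pin (`g` is not monomial), so the torus dictionaries (#14/#16) do not apply to it directly.  This leaf shows that
the (34) torus is conjugate to the (12) torus INSIDE `U(W)(L ⊗ ℝ)`:

* §1 (2×2 linear algebra) at one complex place: an isometry `γ : (ℂ², diag x') ⥲ (ℂ², diag x)` of non-degenerate real diagonal forms
  forces the sign patterns to agree up to the permutation `isoPerm x x'` (Sylvester for `2×2`), so the MONOMIAL matrix
  `isoMat x x' = P_σ · diag(√(x'ᵢ/x_{σ i}))` is an isometry too (`conjTranspose_isoMat_mul_mul`) and conjugates the diagonal torus to a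
  diagonal torus with permuted entries (`isoMat_mul_diagonal_mul_isoMatInv`);
* §2 at every complex place `w` of the CM field: `isoLoc w := σ_w(g) · (isoMat …)⁻¹ ∈ U(diag(a₀,a₁))(L_w)` (`isoLoc_mem_archLocal`);
* §3 **`isoTwist g : U(diag dW)(L⁺ ⊗ ℝ)`** (`archPiEquiv⁻¹` of the `isoLoc w`), **`torusSwap`** (the place-dependent swap of the two circle
  coordinates of `u ∈ T(L⁺ ⊗ ℝ)`), and the HEADLINE **`isoTwist_conj_archConjDiag`**:
  `(isoTwist g)⁻¹ · archConjDiag g dW dW' u · isoTwist g = archDiag dW (torusSwap … u)`.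

Consequence (successor leaf `Side34Transfer`): the (34) fields of `HypSideW` at the W pin are the (12)-type fields transported by the
operator `ρ_η(1, isoTwist g)` (which preserves `𝒮^κ`, Weil's `Θ`-topology and the curves), modulo the (34) value identity.
Nothing here is a claim of PerL/QW8.  Style lint (L-notation): no `local notation`.
-/

set_option autoImplicit false

noncomputable section

open NumberField NumberField.InfinitePlace
open scoped Matrix Classical ComplexConjugate
open Literature.NumberTheory.Automorphic Literature.NumberTheory.Automorphic.UnitaryGroup
open HodgeCM.PerL34

namespace HodgeCM.Model.HypCensus

/-! ## §1 `2 × 2`: monomial isometries between non-degenerate real diagonal forms -/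

section TwoByTwo

variable (x x' : Fin 2 → ℝ)

/-- the permutation matching the signs of `x'` with those of `x`: identity if the first signs agree, the swap otherwise. -/
def isoPerm : Equiv.Perm (Fin 2) := if (0 < x 0 ↔ 0 < x' 0) then 1 else Equiv.swap 0 1

/-- **Sylvester for `2 × 2` diagonal forms**: if `x'` is positive whenever `x` is, negative whenever `x` is, and `det` has the same sign,
then `x'ᵢ / x_{σ i} > 0` for the matching permutation `σ = isoPerm x x'`. -/
theorem isoPerm_ratio_pos (hx : ∀ i, x i ≠ 0) (hx' : ∀ i, x' i ≠ 0)
    (hpos : (∀ i, 0 < x i) → ∀ i, 0 < x' i) (hneg : (∀ i, x i < 0) → ∀ i, x' i < 0)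
    (hdet : 0 < x 0 * x 1 ↔ 0 < x' 0 * x' 1) (i : Fin 2) : 0 < x' i / x (isoPerm x x' i) := by
  have two : ∀ P : Fin 2 → Prop, P 0 → P 1 → ∀ i, P i := fun P h0 h1 i => by
    fin_cases i
    · exact h0
    · exact h1
  rcases lt_or_gt_of_ne (hx 0) with h0 | h0 <;> rcases lt_or_gt_of_ne (hx 1) with h1 | h1
  · -- `x < 0`: then `x' < 0`, `σ = 1`
    have h' := hneg (two _ h0 h1)
    have hσ : isoPerm x x' = 1 := if_pos ⟨fun h => absurd h (not_lt.2 h0.le), fun h => absurd h (not_lt.2 (h' 0).le)⟩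
    rw [hσ, Equiv.Perm.coe_one, id]
    exact div_pos_of_neg_of_neg (h' i) (two (fun i => x i < 0) h0 h1 i)
  · -- `x 0 < 0 < x 1`
    have hd : ¬0 < x' 0 * x' 1 := fun h => (not_lt.2 (mul_nonpos_iff.2 (Or.inr ⟨h0.le, h1.le⟩))) (hdet.2 h)
    rcases lt_or_gt_of_ne (hx' 0) with h0' | h0'
    · have h1' : 0 < x' 1 := by
        by_contra h; exact hd (mul_pos_of_neg_of_neg h0' (lt_of_le_of_ne (not_lt.1 h) (hx' 1)))
      have hσ : isoPerm x x' = 1 := if_pos ⟨fun h => absurd h (not_lt.2 h0.le), fun h => absurd h (not_lt.2 h0'.le)⟩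
      rw [hσ, Equiv.Perm.coe_one, id]
      fin_cases i
      · exact div_pos_of_neg_of_neg h0' h0
      · exact div_pos h1' h1
    · have h1' : x' 1 < 0 := by
        by_contra h; exact hd (mul_pos h0' (lt_of_le_of_ne (not_lt.1 h) (Ne.symm (hx' 1))))
      have hσ : isoPerm x x' = Equiv.swap 0 1 := if_neg fun h => (not_lt.2 h0.le) (h.2 h0')
      rw [hσ]
      fin_cases i
      · show 0 < x' 0 / x (Equiv.swap (0 : Fin 2) 1 0); rw [Equiv.swap_apply_left]; exact div_pos h0' h1
      · show 0 < x' 1 / x (Equiv.swap (0 : Fin 2) 1 1); rw [Equiv.swap_apply_right]; exact div_pos_of_neg_of_neg h1' h0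
  · -- `x 1 < 0 < x 0`
    have hd : ¬0 < x' 0 * x' 1 := fun h => (not_lt.2 (mul_nonpos_iff.2 (Or.inl ⟨h0.le, h1.le⟩))) (hdet.2 h)
    rcases lt_or_gt_of_ne (hx' 0) with h0' | h0'
    · have h1' : 0 < x' 1 := by
        by_contra h; exact hd (mul_pos_of_neg_of_neg h0' (lt_of_le_of_ne (not_lt.1 h) (hx' 1)))
      have hσ : isoPerm x x' = Equiv.swap 0 1 := if_neg fun h => (not_lt.2 h0'.le) (h.1 h0)
      rw [hσ]
      fin_cases i
      · show 0 < x' 0 / x (Equiv.swap (0 : Fin 2) 1 0); rw [Equiv.swap_apply_left]; exact div_pos_of_neg_of_neg h0' h1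
      · show 0 < x' 1 / x (Equiv.swap (0 : Fin 2) 1 1); rw [Equiv.swap_apply_right]; exact div_pos h1' h0
    · have h1' : x' 1 < 0 := by
        by_contra h; exact hd (mul_pos h0' (lt_of_le_of_ne (not_lt.1 h) (Ne.symm (hx' 1))))
      have hσ : isoPerm x x' = 1 := if_pos ⟨fun _ => h0', fun _ => h0⟩
      rw [hσ, Equiv.Perm.coe_one, id]
      fin_cases i
      · exact div_pos h0' h0
      · exact div_pos_of_neg_of_neg h1' h1
  · -- `0 < x`: then `0 < x'`, `σ = 1`
    have h' := hpos (two _ h0 h1)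
    have hσ : isoPerm x x' = 1 := if_pos ⟨fun _ => h' 0, fun _ => h0⟩
    rw [hσ, Equiv.Perm.coe_one, id]
    exact div_pos (h' i) (two (fun i => 0 < x i) h0 h1 i)

/-- the three sign facts from an isometry `γᴴ · diag x · γ = diag x'` (`γ` invertible). -/
theorem sign_facts_of_conjTranspose_mul_mul {γ : Matrix (Fin 2) (Fin 2) ℂ} (hγ : γ.det ≠ 0)
    (h : γᴴ * Matrix.diagonal (fun i => (x i : ℂ)) * γ = Matrix.diagonal fun i => (x' i : ℂ)) :
    ((∀ i, 0 < x i) → ∀ i, 0 < x' i) ∧ ((∀ i, x i < 0) → ∀ i, x' i < 0) ∧ (0 < x 0 * x 1 ↔ 0 < x' 0 * x' 1) := by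
  -- diagonal entries: `x' i = Σ_j ‖γ j i‖² x j`
  have hdiag : ∀ i, x' i = ∑ j, Complex.normSq (γ j i) * x j := fun i => by
    have hi := congrArg (fun M : Matrix (Fin 2) (Fin 2) ℂ => M i i) h
    rw [Matrix.mul_apply] at hi
    simp only [Matrix.mul_diagonal, Matrix.diagonal_apply_eq, Matrix.conjTranspose_apply, RCLike.star_def] at hi
    apply Complex.ofReal_injective
    rw [← hi, Complex.ofReal_sum]
    refine Finset.sum_congr rfl fun j _ => ?_
    rw [Complex.ofReal_mul, Complex.normSq_eq_conj_mul_self]; ring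
  -- a column of an invertible matrix is non-zero
  have hcol : ∀ i, ∃ j, γ j i ≠ 0 := fun i => by
    by_contra hc
    push Not at hc
    apply hγ
    exact Matrix.det_eq_zero_of_column_eq_zero i hc
  -- the determinant identity: `|det γ|² · x 0 · x 1 = x' 0 · x' 1`
  have hdet' : Complex.normSq γ.det * (x 0 * x 1) = x' 0 * x' 1 := by
    have hd := congrArg Matrix.det h
    rw [Matrix.det_mul, Matrix.det_mul, Matrix.det_conjTranspose, Matrix.det_diagonal, Matrix.det_diagonal,
      Fin.prod_univ_two, Fin.prod_univ_two, RCLike.star_def] at hd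
    apply Complex.ofReal_injective
    rw [Complex.ofReal_mul, Complex.ofReal_mul, Complex.ofReal_mul, Complex.normSq_eq_conj_mul_self, ← hd]
    ring
  refine ⟨fun hp i => ?_, fun hn i => ?_, ?_⟩
  · rw [hdiag]
    obtain ⟨j, hj⟩ := hcol i
    refine lt_of_lt_of_le (mul_pos (Complex.normSq_pos.2 hj) (hp j)) ?_
    exact Finset.single_le_sum (f := fun j => Complex.normSq (γ j i) * x j)
      (fun k _ => mul_nonneg (Complex.normSq_nonneg _) (hp k).le) (Finset.mem_univ j)
  · rw [hdiag, Fin.sum_univ_two]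
    have hk : ∀ k, Complex.normSq (γ k i) * x k ≤ 0 := fun k => mul_nonpos_of_nonneg_of_nonpos (Complex.normSq_nonneg _) (hn k).le
    obtain ⟨j, hj⟩ := hcol i
    have hjlt : Complex.normSq (γ j i) * x j < 0 := mul_neg_of_pos_of_neg (Complex.normSq_pos.2 hj) (hn j)
    fin_cases j
    · exact add_neg_of_neg_of_nonpos hjlt (hk 1)
    · exact add_neg_of_nonpos_of_neg (hk 0) hjlt
  · have hγ2 : 0 < Complex.normSq γ.det := Complex.normSq_pos.2 hγ
    rw [← hdet']
    exact (mul_pos_iff_of_pos_left hγ2).symm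

/-- the matching permutation is the identity or the swap. -/
theorem isoPerm_eq_or : isoPerm x x' = 1 ∨ isoPerm x x' = Equiv.swap 0 1 := by
  unfold isoPerm
  split_ifs
  · exact Or.inl rfl
  · exact Or.inr rfl

/-- the scales `cᵢ = √(x'ᵢ / x_{σ i})`. -/
def isoScale (i : Fin 2) : ℝ := Real.sqrt (x' i / x (isoPerm x x' i))

/-- **the monomial isometry `d : (ℂ², diag x') ⥲ (ℂ², diag x)`**, `d eᵢ = cᵢ e_{σ i}`. -/
def isoMat : Matrix (Fin 2) (Fin 2) ℂ := Matrix.of fun j i => if j = isoPerm x x' i then ((isoScale x x' i : ℝ) : ℂ) else 0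

/-- its inverse `eⱼ ↦ c_{σ⁻¹ j}⁻¹ e_{σ⁻¹ j}`. -/
def isoMatInv : Matrix (Fin 2) (Fin 2) ℂ := Matrix.of fun i j => if j = isoPerm x x' i then (((isoScale x x' i : ℝ) : ℂ))⁻¹ else 0

variable {x x'}

/-- (Ported verbatim from the HodgeCMPerL package; no docstring in the source.) -/
theorem isoMat_mul_isoMatInv (hc : ∀ i, isoScale x x' i ≠ 0) : isoMat x x' * isoMatInv x x' = 1 := by
  have h0 : ((isoScale x x' 0 : ℝ) : ℂ) ≠ 0 := Complex.ofReal_ne_zero.2 (hc 0)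
  have h1 : ((isoScale x x' 1 : ℝ) : ℂ) ≠ 0 := Complex.ofReal_ne_zero.2 (hc 1)
  rcases isoPerm_eq_or x x' with hσ | hσ <;>
  · ext j l
    fin_cases j <;> fin_cases l <;>
      simp [isoMat, isoMatInv, hσ, Matrix.mul_apply, Fin.sum_univ_two, Equiv.swap_apply_left, Equiv.swap_apply_right, h0, h1]

/-- (Ported verbatim from the HodgeCMPerL package; no docstring in the source.) -/
theorem isoMatInv_mul_isoMat (hc : ∀ i, isoScale x x' i ≠ 0) : isoMatInv x x' * isoMat x x' = 1 := by
  have h0 : ((isoScale x x' 0 : ℝ) : ℂ) ≠ 0 := Complex.ofReal_ne_zero.2 (hc 0)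
  have h1 : ((isoScale x x' 1 : ℝ) : ℂ) ≠ 0 := Complex.ofReal_ne_zero.2 (hc 1)
  rcases isoPerm_eq_or x x' with hσ | hσ <;>
  · ext j l
    fin_cases j <;> fin_cases l <;>
      simp [isoMat, isoMatInv, hσ, Matrix.mul_apply, Equiv.swap_apply_left, Equiv.swap_apply_right, h0, h1]

/-- `d` as an invertible matrix. -/
def isoMatGL (hc : ∀ i, isoScale x x' i ≠ 0) : GL (Fin 2) ℂ :=
  ⟨isoMat x x', isoMatInv x x', isoMat_mul_isoMatInv hc, isoMatInv_mul_isoMat hc⟩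

/-- (Ported verbatim from the HodgeCMPerL package; no docstring in the source.) -/
@[simp] theorem coe_isoMatGL (hc : ∀ i, isoScale x x' i ≠ 0) : ((isoMatGL hc : GL (Fin 2) ℂ) : Matrix (Fin 2) (Fin 2) ℂ) = isoMat x x' := rfl

/-- (Ported verbatim from the HodgeCMPerL package; no docstring in the source.) -/
@[simp] theorem coe_isoMatGL_inv (hc : ∀ i, isoScale x x' i ≠ 0) :
    (((isoMatGL hc)⁻¹ : GL (Fin 2) ℂ) : Matrix (Fin 2) (Fin 2) ℂ) = isoMatInv x x' := rfl

/-- the scales are non-zero and `c̄ᵢ · x_{σ i} · cᵢ = x'ᵢ` when the ratios are positive. -/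
theorem isoScale_ne_zero (hr : ∀ i, 0 < x' i / x (isoPerm x x' i)) (i : Fin 2) : isoScale x x' i ≠ 0 :=
  (Real.sqrt_pos.2 (hr i)).ne'

/-- (Ported verbatim from the HodgeCMPerL package; no docstring in the source.) -/
theorem isoScale_mul_mul (hx : ∀ i, x i ≠ 0) (hr : ∀ i, 0 < x' i / x (isoPerm x x' i)) (i : Fin 2) :
    ((isoScale x x' i : ℝ) : ℂ) * (x (isoPerm x x' i) : ℂ) * ((isoScale x x' i : ℝ) : ℂ) = (x' i : ℂ) := by
  rw [mul_comm, ← mul_assoc, ← Complex.ofReal_mul, ← Complex.ofReal_mul, isoScale,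
    Real.mul_self_sqrt (hr i).le, div_mul_cancel₀ _ (hx _)]

/-- **`d` is an isometry: `dᴴ · diag x · d = diag x'`.** -/
theorem conjTranspose_isoMat_mul_mul (hx : ∀ i, x i ≠ 0) (hr : ∀ i, 0 < x' i / x (isoPerm x x' i)) :
    (isoMat x x')ᴴ * Matrix.diagonal (fun i => (x i : ℂ)) * isoMat x x' = Matrix.diagonal fun i => (x' i : ℂ) := by
  have h0 := isoScale_mul_mul hx hr 0
  have h1 := isoScale_mul_mul hx hr 1
  rcases isoPerm_eq_or x x' with hσ | hσ
  · simp only [hσ, Equiv.Perm.coe_one, id_eq] at h0 h1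
    ext j l
    fin_cases j <;> fin_cases l <;>
      simp [isoMat, hσ, Matrix.mul_apply, Fin.sum_univ_two, Matrix.conjTranspose_apply, Complex.conj_ofReal, h0, h1]
  · simp only [hσ, Equiv.swap_apply_left, Equiv.swap_apply_right] at h0 h1
    ext j l
    fin_cases j <;> fin_cases l <;>
      simp [isoMat, hσ, Matrix.mul_apply, Fin.sum_univ_two, Matrix.conjTranspose_apply, Equiv.swap_apply_left,
        Equiv.swap_apply_right, Complex.conj_ofReal, h0, h1]

/-- **`d` conjugates the diagonal torus to the diagonal torus with permuted entries**: `d · diag u · d⁻¹ = diag (u ∘ σ⁻¹)`. -/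
theorem isoMat_mul_diagonal_mul_isoMatInv (hc : ∀ i, isoScale x x' i ≠ 0) (u : Fin 2 → ℂ) :
    isoMat x x' * Matrix.diagonal u * isoMatInv x x' = Matrix.diagonal fun j => u ((isoPerm x x').symm j) := by
  have h0 : ((isoScale x x' 0 : ℝ) : ℂ) ≠ 0 := Complex.ofReal_ne_zero.2 (hc 0)
  have h1 : ((isoScale x x' 1 : ℝ) : ℂ) ≠ 0 := Complex.ofReal_ne_zero.2 (hc 1)
  have hu0 : ∀ z : ℂ, ((isoScale x x' 0 : ℝ) : ℂ) * z * (((isoScale x x' 0 : ℝ) : ℂ))⁻¹ = z := fun z => by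
    rw [mul_comm _ z, mul_assoc, mul_inv_cancel₀ h0, mul_one]
  have hu1 : ∀ z : ℂ, ((isoScale x x' 1 : ℝ) : ℂ) * z * (((isoScale x x' 1 : ℝ) : ℂ))⁻¹ = z := fun z => by
    rw [mul_comm _ z, mul_assoc, mul_inv_cancel₀ h1, mul_one]
  rcases isoPerm_eq_or x x' with hσ | hσ
  · have hs : (1 : Equiv.Perm (Fin 2)).symm = 1 := rfl
    ext j l
    fin_cases j <;> fin_cases l <;>
      simp [isoMat, isoMatInv, hσ, hs, Matrix.mul_apply, hu0, hu1]
  · have hs : (Equiv.swap (0 : Fin 2) 1).symm = Equiv.swap 0 1 := Equiv.symm_swap 0 1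
    ext j l
    fin_cases j <;> fin_cases l <;>
      simp [isoMat, isoMatInv, hσ, hs, Matrix.mul_apply, Fin.sum_univ_two, Equiv.swap_apply_left, Equiv.swap_apply_right, hu0, hu1]

end TwoByTwo

/-! ## §2 At a complex place of the CM field: the local isometry `isoLoc w = σ_w(g) · d_w⁻¹ ∈ U(diag dW)(L_w)` -/

section Place

variable (L : Type) [Field L] [NumberField L] [IsCMField L]

/-- the real values `Re σ_w(d j)` of a conjugation-fixed diagonal at the place `w`. -/
def placeRe (d : Fin 2 → L) (w : InfinitePlace L) : Fin 2 → ℝ := fun j => (w.embedding (d j)).re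

variable {L} in
/-- `σ_w(d j)` IS real for a conjugation-fixed `d j`. -/
theorem embedding_eq_placeRe {d : Fin 2 → L} (hd : ∀ i, IsCMField.complexConj L (d i) = d i) (w : InfinitePlace L) (j : Fin 2) :
    w.embedding (d j) = (placeRe L d w j : ℂ) := by
  have h := embedding_galConj (↥(maximalRealSubfield L)) L (IsCMField.complexConj L) ⟨w, IsTotallyComplex.isComplex w⟩
    (UnitaryGroup.complexConj_smul_infinitePlace L w) (IsCMField.complexConj_ne_one L) (d j)
  rw [hd] at h
  exact (Complex.conj_eq_iff_re.1 h.symm).symm ▸ rfl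

variable {L} in
/-- (Ported verbatim from the HodgeCMPerL package; no docstring in the source.) -/
theorem placeRe_ne_zero {d : Fin 2 → L} (hd : ∀ i, IsCMField.complexConj L (d i) = d i) (hd0 : ∀ i, d i ≠ 0) (w : InfinitePlace L)
    (j : Fin 2) : placeRe L d w j ≠ 0 := fun h => by
  have h' := embedding_eq_placeRe hd w j
  rw [h, Complex.ofReal_zero, map_eq_zero] at h'
  exact hd0 j h'

variable {L} in
/-- (Ported verbatim from the HodgeCMPerL package; no docstring in the source.) -/
theorem diagonal_map_embedding {d : Fin 2 → L} (hd : ∀ i, IsCMField.complexConj L (d i) = d i) (w : InfinitePlace L) :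
    (Matrix.diagonal d).map w.embedding = Matrix.diagonal fun j => (placeRe L d w j : ℂ) := by
  rw [Matrix.diagonal_map (map_zero _)]
  exact congrArg Matrix.diagonal (funext fun j => embedding_eq_placeRe hd w j)

variable (dW dW' : Fin 2 → L) (hdW : ∀ i, IsCMField.complexConj L (dW i) = dW i) (hdW0 : ∀ i, dW i ≠ 0)
  (hdW' : ∀ i, IsCMField.complexConj L (dW' i) = dW' i) (hdW0' : ∀ i, dW' i ≠ 0)
  (g : GL (Fin 2) L)
  (hg : ((g : Matrix (Fin 2) (Fin 2) L).map (Literature.AlgebraicGeometry.ShimuraVarieties.conjRingHomK L))ᵀ * Matrix.diagonal dW *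
    (g : Matrix (Fin 2) (Fin 2) L) = Matrix.diagonal dW')

include hdW hdW' hg in
/-- **the rational isometry read at the place `w`**: `σ_w(g)ᴴ · diag(Re σ_w dW) · σ_w(g) = diag(Re σ_w dW')`. -/
theorem conjTranspose_map_embedding_mul_mul (w : InfinitePlace L) :
    ((g : Matrix (Fin 2) (Fin 2) L).map w.embedding)ᴴ * Matrix.diagonal (fun j => (placeRe L dW w j : ℂ)) *
        (g : Matrix (Fin 2) (Fin 2) L).map w.embedding = Matrix.diagonal fun j => (placeRe L dW' w j : ℂ) := by
  have h := congrArg (fun M : Matrix (Fin 2) (Fin 2) L => M.map w.embedding) hg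
  simp only [Matrix.map_mul] at h
  rw [diagonal_map_embedding hdW, diagonal_map_embedding hdW', Matrix.transpose_map, Matrix.map_map] at h
  have hc : (w.embedding : L → ℂ) ∘ (Literature.AlgebraicGeometry.ShimuraVarieties.conjRingHomK L) = starRingEnd ℂ ∘ w.embedding := by
    funext a
    exact embedding_galConj (↥(maximalRealSubfield L)) L (IsCMField.complexConj L) ⟨w, IsTotallyComplex.isComplex w⟩
      (UnitaryGroup.complexConj_smul_infinitePlace L w) (IsCMField.complexConj_ne_one L) a
  have e : (((g : Matrix (Fin 2) (Fin 2) L).map w.embedding).map (starRingEnd ℂ))ᵀ = ((g : Matrix (Fin 2) (Fin 2) L).map w.embedding)ᴴ := by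
    rw [Matrix.conjTranspose, Matrix.transpose_map]; rfl
  rw [hc, ← Matrix.map_map, e] at h
  exact h

omit [NumberField L] [IsCMField L] in
/-- the matrix of `GL₂(f) g` is `g.map f`. -/
theorem coe_GL_map_eq_map {R S : Type*} [CommRing R] [CommRing S] {n : Type*} [Fintype n] [DecidableEq n] (f : R →+* S)
    (g : GL n R) : ((Matrix.GeneralLinearGroup.map f g : GL n S) : Matrix n n S) = (g : Matrix n n R).map f := rfl

omit [NumberField L] [IsCMField L] in
/-- `σ_w(g)` is invertible. -/
theorem det_map_embedding_ne_zero (w : InfinitePlace L) : ((g : Matrix (Fin 2) (Fin 2) L).map w.embedding).det ≠ 0 := by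
  rw [← RingHom.mapMatrix_apply, ← RingHom.map_det]
  exact (map_ne_zero _).2 (Matrix.det_ne_zero_of_left_inverse (B := ((g⁻¹ : GL (Fin 2) L) : Matrix (Fin 2) (Fin 2) L))
    (by rw [← Units.val_mul, inv_mul_cancel, Units.val_one]))

/-- the place permutation `σ_w` (identity or swap). -/
abbrev placePerm (w : InfinitePlace L) : Equiv.Perm (Fin 2) := isoPerm (placeRe L dW w) (placeRe L dW' w)

include hdW hdW0 hdW' hdW0' hg in
/-- the ratios `Re σ_w(dW' i) / Re σ_w(dW (σ_w i))` are positive (Sylvester at `w`). -/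
theorem placeRatio_pos (w : InfinitePlace L) (i : Fin 2) : 0 < placeRe L dW' w i / placeRe L dW w (placePerm L dW dW' w i) := by
  obtain ⟨hp, hn, hd⟩ := sign_facts_of_conjTranspose_mul_mul (placeRe L dW w) (placeRe L dW' w) (det_map_embedding_ne_zero L g w)
    (conjTranspose_map_embedding_mul_mul L dW dW' hdW hdW' g hg w)
  exact isoPerm_ratio_pos _ _ (placeRe_ne_zero hdW hdW0 w) (placeRe_ne_zero hdW' hdW0' w) hp hn hd i

include hdW hdW0 hdW' hdW0' hg in
/-- (Ported verbatim from the HodgeCMPerL package; no docstring in the source.) -/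
theorem placeScale_ne_zero (w : InfinitePlace L) (i : Fin 2) : isoScale (placeRe L dW w) (placeRe L dW' w) i ≠ 0 :=
  isoScale_ne_zero (placeRatio_pos L dW dW' hdW hdW0 hdW' hdW0' g hg w) i

/-- **the local isometry `isoLoc w := σ_w(g) · d_w⁻¹ ∈ GL₂(ℂ)`.** -/
def isoLocGL (w : {w : InfinitePlace L // w.IsComplex}) : GL (Fin 2) ℂ :=
  Matrix.GeneralLinearGroup.map w.1.embedding g * (isoMatGL (placeScale_ne_zero L dW dW' hdW hdW0 hdW' hdW0' g hg w.1))⁻¹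

/-- **`isoLoc w ∈ U(diag dW)(L_w)`.** -/
theorem isoLocGL_mem (w : {w : InfinitePlace L // w.IsComplex}) :
    isoLocGL L dW dW' hdW hdW0 hdW' hdW0' g hg w ∈ archLocal L 2 (Matrix.diagonal dW) w := by
  rw [mem_archLocal_iff_conjTranspose, diagonal_map_embedding hdW, isoLocGL, Units.val_mul, coe_isoMatGL_inv,
    coe_GL_map_eq_map, Matrix.conjTranspose_mul]
  have hd := conjTranspose_isoMat_mul_mul (placeRe_ne_zero hdW hdW0 w.1) (placeRatio_pos L dW dW' hdW hdW0 hdW' hdW0' g hg w.1)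
  have hg' := conjTranspose_map_embedding_mul_mul L dW dW' hdW hdW' g hg w.1
  have hinv := isoMat_mul_isoMatInv (placeScale_ne_zero L dW dW' hdW hdW0 hdW' hdW0' g hg w.1)
  have hinv' : (isoMatInv (placeRe L dW ↑w) (placeRe L dW' ↑w))ᴴ * (isoMat (placeRe L dW ↑w) (placeRe L dW' ↑w))ᴴ = 1 := by
    rw [← Matrix.conjTranspose_mul, hinv, Matrix.conjTranspose_one]
  set G := (g : Matrix (Fin 2) (Fin 2) L).map w.1.embedding
  set d := isoMat (placeRe L dW ↑w) (placeRe L dW' ↑w)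
  set d' := isoMatInv (placeRe L dW ↑w) (placeRe L dW' ↑w)
  calc d'ᴴ * Gᴴ * Matrix.diagonal (fun j => (placeRe L dW w j : ℂ)) * (G * d')
      = d'ᴴ * (Gᴴ * Matrix.diagonal (fun j => (placeRe L dW w j : ℂ)) * G) * d' := by simp only [Matrix.mul_assoc]
    _ = d'ᴴ * (dᴴ * Matrix.diagonal (fun j => (placeRe L dW w j : ℂ)) * d) * d' := by rw [hg', hd]
    _ = (d'ᴴ * dᴴ) * Matrix.diagonal (fun j => (placeRe L dW w j : ℂ)) * (d * d') := by simp only [Matrix.mul_assoc]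
    _ = Matrix.diagonal fun j => (placeRe L dW w j : ℂ) := by rw [hinv', hinv, Matrix.one_mul, Matrix.mul_one]

/-- the local isometry as an element of `U(diag dW)(L_w)`. -/
def isoLoc (w : {w : InfinitePlace L // w.IsComplex}) : archLocal L 2 (Matrix.diagonal dW) w :=
  ⟨isoLocGL L dW dW' hdW hdW0 hdW' hdW0' g hg w, isoLocGL_mem L dW dW' hdW hdW0 hdW' hdW0' g hg w⟩

/-! ## §3 The archimedean twist `isoTwist g ∈ U(diag dW)(L⁺ ⊗ ℝ)` and the place-dependent swap of the torus -/

/-- **THE ARCHIMEDEAN TWIST**: the element of `U(diag dW)(L⁺ ⊗ ℝ)` with components `isoLoc w`. -/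
def isoTwist : UnitaryGroup.arch (↥(maximalRealSubfield L)) L (IsCMField.complexConj L) 2 (Matrix.diagonal dW) :=
  (archPiEquiv (↥(maximalRealSubfield L)) L (IsCMField.complexConj L) 2 (Matrix.diagonal dW) (IsCMField.complexConj_ne_one L)
    (UnitaryGroup.complexConj_smul_infinitePlace L)).symm (isoLoc L dW dW' hdW hdW0 hdW' hdW0' g hg)

/-- (Ported verbatim from the HodgeCMPerL package; no docstring in the source.) -/
theorem archAt_isoTwist (w : {w : InfinitePlace L // w.IsComplex}) :
    archAt (↥(maximalRealSubfield L)) L (IsCMField.complexConj L) 2 (Matrix.diagonal dW) w (UnitaryGroup.complexConj_smul_infinitePlace L _)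
        (IsCMField.complexConj_ne_one L) (isoTwist L dW dW' hdW hdW0 hdW' hdW0' g hg) = isoLoc L dW dW' hdW hdW0 hdW' hdW0' g hg w :=
  archAt_archPiEquiv_symm _ _ _ _ _ _ _ _ w

/-- permuting the two circle coordinates by `σ`. -/
def permPair (σ : Equiv.Perm (Fin 2)) : Circle × Circle →* Circle × Circle where
  toFun p := (![p.1, p.2] (σ 0), ![p.1, p.2] (σ 1))
  map_one' := by
    have h : ∀ i : Fin 2, (![(1 : Circle), 1] i) = 1 := fun i => by fin_cases i <;> rfl
    exact Prod.ext (h _) (h _)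
  map_mul' p q := by
    have h : ∀ i : Fin 2, ![p.1 * q.1, p.2 * q.2] i = ![p.1, p.2] i * ![q.1, q.2] i := fun i => by fin_cases i <;> rfl
    exact Prod.ext (h _) (h _)

/-- **the place-dependent swap of `T(L⁺ ⊗ ℝ)`**: at each infinite place permute the two circle coordinates by `σ w`. -/
def torusSwap (σ : InfinitePlace L → Equiv.Perm (Fin 2)) : SeesawArchTorus L →* SeesawArchTorus L :=
  (SeesawArchTorus.placesEquiv L).symm.toMonoidHom.comp
    ((MonoidHom.pi fun w => (permPair (σ w)).comp (Pi.evalMonoidHom (fun _ : InfinitePlace L => Circle × Circle) w)).comp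
      (SeesawArchTorus.placesEquiv L).toMonoidHom)

/-- (Ported verbatim from the HodgeCMPerL package; no docstring in the source.) -/
theorem placesEquiv_torusSwap (σ : InfinitePlace L → Equiv.Perm (Fin 2)) (u : SeesawArchTorus L) (w : InfinitePlace L) :
    SeesawArchTorus.placesEquiv L (torusSwap L σ u) w = permPair (σ w) (SeesawArchTorus.placesEquiv L u w) := by
  show SeesawArchTorus.placesEquiv L ((SeesawArchTorus.placesEquiv L).symm _) w = _
  rw [ContinuousMulEquiv.apply_symm_apply]
  rfl


-- port_pkg: scope closed for this part
end Place
end HodgeCM.Model.HypCensus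
end
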